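import Literature.Probability.Percolation.ZdFiveArmMonotone
import Literature.Probability.Percolation.BondPercolationSymmetry
import HarnessLib

/-!
# Five-arm construction for bond `ℤ²`: the counting step (union bound over the centre)

Topic `Literature/Probability/Percolation`; proofs only (no definition, no named fact). File "5E"
of the five-arm lower bound for bond percolation on `ℤ²` in the bottom-up layers towards
`Kesten1987_zdKestenRelation` (`ZdNearCriticalWindow.lean`): the passage from "with probability
`≥ C` SOME site `v` of the central box is a five-arm site" to a lower bound for the five-arm
probability of a FIXED annulus (Nolin 2008, §5.2, proof of Thm. 24 (ii) [arXiv 0711.4948: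
Thm. 23 (ii)], last display: `P(⋃_{v ∈ S_{N/2}} {v ⇝⁵ ∂S_N}) ≤ Σ_v P(v ⇝⁵ ∂S_N) ≤ C' N² P(0 ⇝⁵ ∂S_N)`;
here without the arm-separation-based comparability of the paper: translation invariance and
truncation of the arms to a common annulus, `real_zdFiveArmClusters_mono`):

* `real_exists_shift_mem_le_card_mul` — **union bound with translation invariance**:
  `P_p(∃ v ∈ B, ω - v ∈ E) ≤ |B| · P_p(E)` for any finite set of centres `B` and any event `E`;
* `real_exists_shift_mem_zdFiveArmClusters_le` — the same for the five-arm event, combined with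
  monotonicity in the radii: if around some `v ∈ B` the translated configuration has five arms
  across `A_{m,n(v)}` with `n(v) ≥ n₀ ≥ m`, then `P ≤ |B| · P_p(𝒜₅(A_{m,n₀}))`.
-/

noncomputable section

open MeasureTheory Set

namespace Literature.Probability.Percolation

open LatticeModels

/-- **Union bound with translation invariance**: for a finite set `B` of centres and an event `E`,
`P_p(∃ v ∈ B, (ω translated by -v) ∈ E) ≤ |B| · P_p(E)` (`measureReal_biUnion_finset_le` and
`bondPercolation_real_preimage_shift`). This is the step
"`P(⋃_v {v ⇝⁵ ∂S_N}) ≤ Σ_v P(v ⇝⁵ ∂S_N)`" of Nolin 2008, proof of Thm. 24 (ii).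
[cite: Nolin2008, §5.2, proof of Thm. 24 (ii) (arXiv 0711.4948: Thm. 23 (ii))] -/
theorem real_exists_shift_mem_le_card_mul (p : unitInterval) (B : Finset (Site 2))
    (E : Set (BondConfig (Site 2))) :
    (bondPercolation (zdGraph 2) p).real
        {ω | ∃ v ∈ B, BondConfig.relabel (sym2Equiv (Site.shift (-v))) ω ∈ E} ≤
      B.card * (bondPercolation (zdGraph 2) p).real E := by
  set μ := bondPercolation (zdGraph 2) p with hμ
  have hcover : {ω : BondConfig (Site 2) | ∃ v ∈ B, BondConfig.relabel (sym2Equiv (Site.shift (-v))) ω ∈ E} ⊆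
      ⋃ v ∈ B, BondConfig.relabel (sym2Equiv (Site.shift (-v))) ⁻¹' E := by
    intro ω hω
    obtain ⟨v, hv, h⟩ := hω
    exact Set.mem_biUnion (Finset.mem_coe.2 hv) h
  calc μ.real {ω | ∃ v ∈ B, BondConfig.relabel (sym2Equiv (Site.shift (-v))) ω ∈ E}
      ≤ μ.real (⋃ v ∈ B, BondConfig.relabel (sym2Equiv (Site.shift (-v))) ⁻¹' E) :=
        measureReal_mono hcover (measure_ne_top _ _)
    _ ≤ ∑ v ∈ B, μ.real (BondConfig.relabel (sym2Equiv (Site.shift (-v))) ⁻¹' E) :=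
        measureReal_biUnion_finset_le _ _
    _ = ∑ _v ∈ B, μ.real E := Finset.sum_congr rfl fun v _ => bondPercolation_real_preimage_shift (-v) p E
    _ = B.card * μ.real E := by rw [Finset.sum_const, nsmul_eq_mul]

/-- **Counting five-arm centres**: if with probability `≥ C` there is a centre `v ∈ B` around
which the translated configuration has five arms across `A_{m,n(v)}` for some outer radius
`n(v) ≥ n₀` (`m ≤ n₀`), then `C ≤ |B| · P_p(𝒜₅(A_{m,n₀}))` — truncate the arms to the common
annulus `A_{m,n₀}` (`mem_zdFiveArmClusters_mono`) and apply the union bound. (Nolin 2008, proof of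
Thm. 24 (ii), last display, with translation invariance and truncation in place of the
comparability of five-arm probabilities at different sites.) [cite: Nolin2008, §5.2, proof of Thm. 24 (ii) (arXiv 0711.4948: Thm. 23 (ii))] -/
theorem real_exists_shift_mem_zdFiveArmClusters_le (p : unitInterval) (B : Finset (Site 2)) {m n₀ : ℕ}
    (hmn : m ≤ n₀) (nv : Site 2 → ℕ) (hnv : ∀ v ∈ B, n₀ ≤ nv v) :
    (bondPercolation (zdGraph 2) p).real
        {ω | ∃ v ∈ B, BondConfig.relabel (sym2Equiv (Site.shift (-v))) ω ∈ zdFiveArmClusters m (nv v)} ≤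
      B.card * (bondPercolation (zdGraph 2) p).real (zdFiveArmClusters m n₀) := by
  refine le_trans (measureReal_mono (fun ω hω => ?_) (measure_ne_top _ _))
    (real_exists_shift_mem_le_card_mul p B (zdFiveArmClusters m n₀))
  obtain ⟨v, hv, h⟩ := hω
  exact ⟨v, hv, mem_zdFiveArmClusters_mono le_rfl hmn (hnv v hv) h⟩

end Literature.Probability.Percolation
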